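import Summits.KontsevichZagierPeriods.KontsevichZagierPeriods.Theses.SymplecticScissors
import Literature.NumberTheory.Transcendental.AyoubPeriodSeries
import Literature.NumberTheory.Transcendental.AyoubPeriodSeriesKernel
import Literature.NumberTheory.Transcendental.AyoubPeriodSeriesPiAlgebraic
import Summits.KontsevichZagierPeriods.KontsevichZagierPeriods.Theorems.UnfoldedStokesStokesGenerationStubSpanToRepsAuxCoeff
import Mathlib.RingTheory.MvPowerSeries.Rename
import Mathlib.RingTheory.MvPowerSeries.Substitution
import Mathlib.RingTheory.MvPowerSeries.Inverse
import Mathlib.RingTheory.PowerSeries.Basic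
import Summits.KontsevichZagierPeriods.KontsevichZagierPeriods.Theorems.SymplecticScissorsTypeAGenerationStubRestrCZero
import Summits.KontsevichZagierPeriods.KontsevichZagierPeriods.Theorems.SymplecticScissorsTypeAGenerationStubRoomLemmaIter
import Summits.KontsevichZagierPeriods.KontsevichZagierPeriods.Theorems.SymplecticScissorsTypeAGenerationStubSubstRoom
import Summits.KontsevichZagierPeriods.KontsevichZagierPeriods.Theorems.SymplecticScissorsTypeAGenerationStubRoomStepCongruence
import Summits.KontsevichZagierPeriods.KontsevichZagierPeriods.Theorems.SymplecticScissorsTypeAGenerationStubRestrCOneAux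

/-!
# `TypeAGeneration` (stmt-KontsevichZagierPeriods-18392), line `Sketch`, stub
`stub_unitOfSmallDeviation_of` (U1b): the small-deviation unit lemma

Registered stub `stub_unitOfSmallDeviation_of` of the crux `TypeAGeneration` (route
SymplecticScissors, line `Sketch` = card stokes-compiler), on top of
`Literature/NumberTheory/Transcendental/AyoubPeriodSeries.lean` (`AyoubRel.Oan σ = 𝒪_{k-alg}(𝔻̄^∞)`:
power series in finitely many `zᵢ`, of polyradius `> 1`, algebraic over `k(z)`;
`AyoubRel.restrC i 0 = (·)|_{zᵢ=0}`) and of the sibling stub files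
`SymplecticScissorsTypeAGenerationStubRestrCZero.lean` (`W|_{zᵢ=0} ∈ 𝒪_{k-alg}(𝔻̄^∞)`),
`…StubRoomLemmaIter.lean` (variables, anisotropic-to-isotropic weights `s6_iso`),
`…StubSubstRoom.lean` (`s3_exists_lower`), `…StubRoomStepCongruence.lean` (`zₗ ∈ 𝒪_{k-alg}(𝔻̄^∞)`,
coefficients of `zⱼ T`) and `…StubRestrCOneAux.lean` (multiplicativity of the weight `ρ^a`).

ADMISSIBILITY MADE ALGEBRAIC. Given (U0) the submultiplicativity of the weighted `ℓ¹` norms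
`N_ρ(F) = Σ_a ‖F_a‖ ρ^a` and (U1a) the geometric majorant (for `ψ` with zero constant coefficient
and `N_ρ(ψ) ≤ q < 1`, `V' = Σ_m ψ^m` satisfies `(1 − ψ) V' = 1`, `N_ρ(V') ≤ 1/(1−q)`, and uses only
variables of `ψ`) as hypotheses: for `W ∈ 𝒪_{k-alg}(𝔻̄^∞)` whose face `W₀ = W|_{zᵢ=0}` has an
inverse `U ∈ 𝒪_{k-alg}(𝔻̄^∞)` with weights `ρ > 1`, and whose deviation `D = (W − W₀) U` has
`ρⱼ N_ρ(D) < 1`, the straight-line interpolant `W̃ = W₀ + zⱼ (W − W₀)` is a unit of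
`𝒪_{k-alg}(𝔻̄^∞)` with inverse of weights `ρ`.

Proof: with `ψ = −zⱼ D` (`N_ρ(ψ) = ρⱼ N_ρ(D) < 1`, `u2_hasSum_neg_X_mul`) one has
`W̃ = W₀ (1 − ψ)` because `W₀ U = 1`, so `V = U V'` is a right inverse of `W̃` (`u2_mul_eq_one`),
hence the `MvPowerSeries` inverse (`u2_inv_eq`); its weights come from (U0), its variables from
those of `U` and `ψ`, its polyradius from the weights (`s6_iso`), and its algebraicity over `k(z)`
from that of `W̃` through the reversed polynomial `Y^{deg P} P(1/Y)`
(`u2_isAlgebraic_of_mul_eq_one`, `Polynomial.eval₂_reverse_eq_zero_iff`).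

Elementary (folklore); no definition is introduced. Helper names carry the prefix `u2`.
-/

noncomputable section

-- `Summit.KontsevichZagierPeriods.KontsevichZagierPeriods.…` is the tree's mandated layout (single-conjunct summit).
set_option linter.dupNamespace false

namespace Summit.KontsevichZagierPeriods.KontsevichZagierPeriods.TypeAGenerationLine

open Finsupp MvPowerSeries
open Literature.NumberTheory.Transcendental
open Literature.NumberTheory.Transcendental.AyoubRel
open Summit.KontsevichZagierPeriods.KontsevichZagierPeriods.Theses.SymplecticScissors (TypeAGeneration)

/-! ## Weights of `ψ = −zⱼ D` -/

/-- **`N_ρ(−zⱼ D) = ρⱼ N_ρ(D)`**: the weighted `ℓ¹` family of `−zⱼ D` is that of `D` reindexed along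
`b ↦ b + eⱼ` (`coeff_{b+eⱼ} (zⱼ D) = coeff_b D`, `ρ^{b+eⱼ} = ρ^b ρⱼ`) and vanishes off its image
(`bⱼ = 0`). [folklore] -/
theorem u2_hasSum_neg_X_mul (j : ℕ) (D : CSeries) (ρ : ℕ → ℝ) {S : ℝ}
    (hS : HasSum (fun a : ℕ →₀ ℕ => ‖coeff a D‖ * a.prod fun l n => ρ l ^ n) S) :
    HasSum (fun a : ℕ →₀ ℕ => ‖coeff a (-(X j * D))‖ * a.prod fun l n => ρ l ^ n) (ρ j * S) := by
  have hinj : Function.Injective fun b : ℕ →₀ ℕ => b + single j 1 :=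
    fun b b' h => add_right_cancel h
  refine (hinj.hasSum_iff fun x hx => ?_).mp ?_
  · have hxj : x j = 0 := by
      by_contra h
      exact hx ⟨x - single j 1,
        tsub_add_cancel_of_le (single_le_iff.mpr (Nat.one_le_iff_ne_zero.mpr h))⟩
    rw [map_neg, norm_neg, s2_coeff_X_mul_of_zero D hxj, norm_zero, zero_mul]
  · have heq : ((fun a : ℕ →₀ ℕ => ‖coeff a (-(X j * D))‖ * a.prod fun l n => ρ l ^ n) ∘
          fun b : ℕ →₀ ℕ => b + single j 1) =
        fun b : ℕ →₀ ℕ => (‖coeff b D‖ * b.prod fun l n => ρ l ^ n) * ρ j := by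
      funext b
      simp only [Function.comp_apply]
      rw [map_neg, norm_neg, s2_coeff_X_mul_add_single, s4_weight_add, s4_weight_single, pow_one,
        mul_assoc]
    rw [heq, mul_comm]
    exact hS.mul_right (ρ j)

/-! ## Right inverses in `ℂ[[z]]` -/

/-- **`W̃ V = 1`**: from `W₀ U = 1` and `(1 − ψ) V' = 1` with `ψ = −zⱼ T U`,
`(W₀ + zⱼ T)(U V') = 1` (`W₀ + zⱼ T = W₀ (1 − ψ)`). [folklore] -/
theorem u2_mul_eq_one (j : ℕ) {W₀ T U Vp : CSeries} (h1 : W₀ * U = 1)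
    (h2 : (1 - -(X j * (T * U))) * Vp = 1) : (W₀ + X j * T) * (U * Vp) = 1 := by
  linear_combination Vp * h1 + h2

/-- A right inverse forces a non-zero constant coefficient. [folklore] -/
theorem u2_constantCoeff_ne_zero {F G : CSeries} (h : F * G = 1) : constantCoeff F ≠ 0 := by
  intro h0
  have h1 := congrArg constantCoeff h
  rw [map_mul, h0, zero_mul, map_one] at h1
  exact zero_ne_one h1

/-- A right inverse is the `MvPowerSeries` inverse (over the field `ℂ`). [folklore] -/
theorem u2_inv_eq {F G : CSeries} (h : F * G = 1) : F⁻¹ = G :=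
  (MvPowerSeries.inv_eq_iff_mul_eq_one (u2_constantCoeff_ne_zero h)).mpr ((mul_comm G F).trans h)

/-- **The inverse of a unit algebraic over `k(z)` is algebraic over `k(z)`**: if `P(F) = 0` with
`P ≠ 0`, the reversed polynomial `Y^{deg P} P(1/Y) ≠ 0` kills `G = F⁻¹`. [folklore] -/
theorem u2_isAlgebraic_of_mul_eq_one {k : Type} [Field k] (σ : k →+* ℂ) {F G : CSeries}
    (hF : IsAlgebraicOverRatFunc σ F) (hFG : F * G = 1) : IsAlgebraicOverRatFunc σ G := by
  obtain ⟨P, hP0, hP⟩ := hF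
  letI : Invertible F := ⟨G, (mul_comm G F).trans hFG, hFG⟩
  exact ⟨P.reverse, fun h => hP0 (Polynomial.reverse_eq_zero.mp h),
    (Polynomial.eval₂_reverse_eq_zero_iff (polyToCSeries σ) F P).mpr hP⟩

/-! ## The stub -/

/-- U1b — THE SMALL-DEVIATION UNIT LEMMA (given U0 and U1a): for `W ∈ 𝒪_{k-alg}(𝔻̄^∞)` whose face
`W₀ = W|_{zᵢ=0}` is a unit (inverse `U ∈ 𝒪_{k-alg}(𝔻̄^∞)` given, with weights `ρ`) and whose
deviation `D = (W − W₀) U` has `ρ_j N_ρ(D) < 1`, the straight-line interpolant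
`W̃ = W₀ + z_j (W − W₀)` is a unit of `𝒪_{k-alg}(𝔻̄^∞)`, its inverse (`MvPowerSeries` inverse over
the field `ℂ`) having the weights `ρ`. [folklore] -/
theorem stub_unitOfSmallDeviation_of :
    (∀ (F G : CSeries) (ρ : ℕ → ℝ), (∀ l, 0 ≤ ρ l) →
      ∀ (A B : ℝ),
        HasSum (fun a : ℕ →₀ ℕ => ‖MvPowerSeries.coeff a F‖ * a.prod fun l n => ρ l ^ n) A →
        HasSum (fun a : ℕ →₀ ℕ => ‖MvPowerSeries.coeff a G‖ * a.prod fun l n => ρ l ^ n) B →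
        ∃ P : ℝ, P ≤ A * B ∧
          HasSum (fun a : ℕ →₀ ℕ => ‖MvPowerSeries.coeff a (F * G)‖ * a.prod fun l n => ρ l ^ n) P) →
    (∀ (ψ : CSeries), MvPowerSeries.constantCoeff ψ = 0 →
      ∀ (ρ : ℕ → ℝ), (∀ l, 0 ≤ ρ l) → ∀ (q : ℝ), q < 1 →
        (∃ A : ℝ, A ≤ q ∧
          HasSum (fun a : ℕ →₀ ℕ => ‖MvPowerSeries.coeff a ψ‖ * a.prod fun l n => ρ l ^ n) A) →
        (1 - ψ) * MvPowerSeries.subst (fun _ : Unit => ψ) (PowerSeries.mk fun _ : ℕ => (1 : ℂ)) = 1 ∧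
        (∃ P : ℝ, P ≤ 1 / (1 - q) ∧
          HasSum (fun a : ℕ →₀ ℕ =>
            ‖MvPowerSeries.coeff a (MvPowerSeries.subst (fun _ : Unit => ψ) (PowerSeries.mk fun _ : ℕ => (1 : ℂ)))‖ *
              a.prod fun l n => ρ l ^ n) P) ∧
        (∀ l : ℕ, UsesVar (MvPowerSeries.subst (fun _ : Unit => ψ) (PowerSeries.mk fun _ : ℕ => (1 : ℂ))) l →
          UsesVar ψ l)) →
    ∀ (k : Type) [Field k] [CharZero k] (σ : k →+* ℂ) (i j : ℕ), i ≠ j →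
      ∀ (W U : CSeries), W ∈ Oan σ → U ∈ Oan σ → restrC i 0 W * U = 1 →
      ∀ (ρ : ℕ → ℝ), (∀ l, 1 < ρ l) →
        Summable (fun a : ℕ →₀ ℕ => ‖MvPowerSeries.coeff a U‖ * a.prod fun l n => ρ l ^ n) →
        ∀ (S : ℝ),
          HasSum (fun a : ℕ →₀ ℕ => ‖MvPowerSeries.coeff a ((W - restrC i 0 W) * U)‖ * a.prod fun l n => ρ l ^ n) S →
          ρ j * S < 1 →
          (restrC i 0 W + X j * (W - restrC i 0 W))⁻¹ ∈ Oan σ ∧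
          (restrC i 0 W + X j * (W - restrC i 0 W)) * (restrC i 0 W + X j * (W - restrC i 0 W))⁻¹ = 1 ∧
          Summable (fun a : ℕ →₀ ℕ =>
            ‖MvPowerSeries.coeff a (restrC i 0 W + X j * (W - restrC i 0 W))⁻¹‖ * a.prod fun l n => ρ l ^ n) := by
  intro hU0 hU1a k _ _ σ i j _ W U hW hU hWU ρ hρ hUs S hS hjS
  have hρ0 : ∀ l, 0 ≤ ρ l := fun l => zero_le_one.trans (hρ l).le
  have hW₀ : restrC i 0 W ∈ Oan σ := (stub_restrCZeroMemOan k σ W hW i).1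
  -- (1) the geometric series `V'` of `ψ = -(z_j D)`, `N_ρ(ψ) = ρ_j S < 1`
  have hψ0 : constantCoeff (-(X j * ((W - restrC i 0 W) * U))) = 0 := by
    rw [map_neg, map_mul, constantCoeff_X, zero_mul, neg_zero]
  obtain ⟨hgeom, ⟨P, -, hV's⟩, hV'var⟩ :=
    hU1a _ hψ0 ρ hρ0 (ρ j * S) hjS ⟨ρ j * S, le_rfl, u2_hasSum_neg_X_mul j _ ρ hS⟩
  -- (2) `W̃ (U V') = 1`, so `W̃⁻¹ = U V'`
  have hWV := u2_mul_eq_one j hWU hgeom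
  rw [u2_inv_eq hWV]
  -- (3) weights of `U V'` by submultiplicativity
  obtain ⟨P', -, hP'⟩ := hU0 _ _ ρ hρ0 _ _ hUs.hasSum hV's
  refine ⟨(mem_Oan_iff σ _).mpr ?_, hWV, hP'.summable⟩
  -- (4) `U V' ∈ 𝒪_{k-alg}(𝔻̄^∞)`: variables, polyradius, algebraicity
  have hψOan : -(X j * ((W - restrC i 0 W) * U)) ∈ Oan σ :=
    neg_mem_Oan σ (mul_mem_Oan σ (s2_X_mem_Oan σ j) (mul_mem_Oan σ (sub_mem_Oan σ hW hW₀) hU))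
  obtain ⟨Nψ, hNψ⟩ := hψOan.1
  obtain ⟨NU, hNU⟩ := hU.1
  have hVdep := hNU.mul (s6_dependsOnlyOnLT_of_usesVar fun l hl => s6_lt_of_usesVar hNψ (hV'var l hl))
  obtain ⟨r, hr1, hr⟩ := s3_exists_lower ρ hρ (max NU Nψ)
  have hWtOan : restrC i 0 W + X j * (W - restrC i 0 W) ∈ Oan σ :=
    add_mem_Oan σ hW₀ (mul_mem_Oan σ (s2_X_mem_Oan σ j) (sub_mem_Oan σ hW hW₀))
  exact ⟨⟨_, hVdep⟩,
    ⟨r, hr1, s6_iso (fun l hl => s6_lt_of_usesVar hVdep hl) (zero_le_one.trans hr1.le) hr hP'.summable⟩,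
    u2_isAlgebraic_of_mul_eq_one σ hWtOan.2.2 hWV⟩

end Summit.KontsevichZagierPeriods.KontsevichZagierPeriods.TypeAGenerationLine
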